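import Mathlib
import HarnessLib
import Summits.RiemannHypothesis.RiemannHypothesis.Theses.WeilParity
import Summits.RiemannHypothesis.RiemannHypothesis.Theses.GroundBarta
import Summits.RiemannHypothesis.RiemannHypothesis.Theorems.WeilParityEvenWinsBeyondArchSplit
import Summits.RiemannHypothesis.RiemannHypothesis.Theorems.WeilParityEvenWinsBeyondArchFrontier63
import Summits.RiemannHypothesis.RiemannHypothesis.Theorems.WeilGroundStateGroundStateSimpleEvenCellTransfer
import Summits.RiemannHypothesis.RiemannHypothesis.Theorems.WeilGroundStateGroundStateSimpleEvenTwoPrimeWindows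
import Summits.RiemannHypothesis.RiemannHypothesis.Theorems.WeilGroundStateGroundStateSimpleEvenOfNoParityCrossing
import Summits.RiemannHypothesis.RiemannHypothesis.Theorems.WeilParityEvenWinsBeyondArchFrontier64
import Summits.RiemannHypothesis.RiemannHypothesis.Theorems.WeilGroundStateGroundStateSimpleEvenTrialUpperJ
import Summits.RiemannHypothesis.RiemannHypothesis.Theorems.WeilGroundStateGroundStateSimpleEvenOddLowerI65

/-!
# Cruxes `NoParityCrossing` (stmt-RiemannHypothesis-18085), `GroundStateSimpleEven` (stmt-RiemannHypothesis-1526) and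
# `EvenWinsBeyondArch` (stmt-RiemannHypothesis-15432; GroundBarta rung 4 = stmt-RiemannHypothesis-18807):
# the RH-free frontier moves from `16/25` to `13/20`

Support file.  Cell `G₂ = [16/25, 13/20]` of the `{2,3}`-window ladder (item 18085, stub `stub_twoThreeWindowSimpleEven`) is
closed RH-free by the landed cell transfer `GroundStateSimpleEven.weilWindowSimpleEven_on_cell_of_le` from

* the U-side `trialUpperJ : ε(16/25) ≤ 1/10000000000` (exact-rational Rayleigh–Ritz, degree-24 windowed polynomial), and
* the L-side `oddLowerI65 : Re Q(g) ≥ 1/2000000000` for odd normalised `g` on `[-13/20, 13/20]` (the kernel-checked two-prime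
  odd-sector margin certificate `weilCert23I`, Yoshida moment method, `Literature/…/WeilTwoPrimeOddMarginI*.lean`),

`1/10000000000 < 1/2000000000`, on top of the frontier `16/25` (`…Frontier64.lean`, cell `G₁`).  Consequences: `WeilWindowSimpleEven a`
and the strict parity order `ε_ev(a) < ε_od(a)` on EVERY window `0 < a ≤ 13/20`; item 18085 ↔ "no parity tie beyond `13/20`";
`GroundStateSimpleEven` ↔ the same; `EvenWinsBeyondArch` (WeilParity and the GroundBarta copy) from "no tie beyond `13/20`".  The next
cell starts at `13/20`, whose U-side `trialUpperK : ε(13/20) ≤ 9/200000000000` is landed; its L-side needs `N > 157` (FEASIBILITY-GH.md on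
item 18085).  Mathlib + landed tree files only; no definitions, no named facts, no `sorry`.
-/

noncomputable section

open Set MeasureTheory

-- D-0017: single-problem summit ⇒ namespace `Summit.RiemannHypothesis.RiemannHypothesis.…` by design.
set_option linter.dupNamespace false

namespace Summit.RiemannHypothesis.RiemannHypothesis.Theorems.EvenWinsBeyondArch

open Literature.NumberTheory.LFunctions
open Summit.RiemannHypothesis.RiemannHypothesis.Theses.WeilParity
open Summit.RiemannHypothesis.RiemannHypothesis.Theses.WeilGroundState

/-! ## Cell `G₂ = [16/25, 13/20]` and the clause up to `13/20` -/

/-- **Cell `G₂`**: `WeilWindowSimpleEven a` for every `16/25 ≤ a ≤ 13/20` (cell transfer with `U = 1/10¹⁰ < L = 1/(2·10⁹)`). [folklore] -/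
theorem weilWindowSimpleEven_on_cell_G2 {a : ℝ} (hlo : (16 / 25 : ℝ) ≤ a) (hhi : a ≤ 13 / 20) :
    WeilWindowSimpleEven a :=
  GroundStateSimpleEven.weilWindowSimpleEven_on_cell_of_le (b := 16 / 25) (c := 13 / 20)
    (U := 1 / 10000000000) (L := 1 / 2000000000) (by norm_num) (by norm_num)
    Summit.RiemannHypothesis.RiemannHypothesis.Theorems.trialUpperJ
    Summit.RiemannHypothesis.RiemannHypothesis.Theorems.oddLowerI65 hlo hhi

/-- **The Connes–van Suijlekom hypothesis on every window `0 < a ≤ 13/20` (RH-free)**: up to `16/25` (`weilWindowSimpleEven_of_le_16_25`)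
and the new cell `G₂`. [folklore] -/
theorem weilWindowSimpleEven_of_le_13_20 : ∀ a : ℝ, 0 < a → a ≤ 13 / 20 → WeilWindowSimpleEven a := by
  intro a ha hhi
  rcases le_or_gt a (16 / 25) with hle | hlt
  · exact weilWindowSimpleEven_of_le_16_25 a ha hle
  · exact weilWindowSimpleEven_on_cell_G2 hlt.le hhi

/-- **Strict parity order up to `13/20`**: `ε_ev(a) < ε_od(a)` for `0 < a ≤ 13/20`. RH-free. [folklore] -/
theorem weilEvenGroundEnergy_lt_weilOddGroundEnergy_of_le_13_20 {a : ℝ} (ha : 0 < a) (hhi : a ≤ 13 / 20) :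
    weilEvenGroundEnergy a < weilOddGroundEnergy a :=
  (weilWindowSimpleEven_iff_weilEvenGroundEnergy_lt ha).1 (weilWindowSimpleEven_of_le_13_20 a ha hhi)

/-- **Every ground state at every window `0 < a ≤ 13/20` is a.e. even.** [folklore] -/
theorem groundStates_ae_even_of_le_13_20 :
    ∀ a : ℝ, 0 < a → a ≤ 13 / 20 → ∀ u : ℝ → ℂ, IsWeilGroundState a u → u =ᵐ[volume] fun t ↦ u (-t) :=
  fun a ha hhi ↦ (GroundStateSimpleEven.weilWindowSimpleEven_iff_groundStates_ae_even ha).1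
    (weilWindowSimpleEven_of_le_13_20 a ha hhi)

/-! ## The residues after cell `G₁`: no parity tie beyond `13/20` -/

/-- **No tie beyond `13/20` ⟹ `NoParityCrossing`** (item stmt-RiemannHypothesis-18085). [folklore] -/
theorem noParityCrossing_of_beyond_13_20
    (h : ∀ a : ℝ, 13 / 20 < a → weilEvenGroundEnergy a ≠ weilOddGroundEnergy a) : NoParityCrossing := by
  intro a ha
  rcases le_or_gt a (13 / 20) with hle | hlt
  · have ha0 : 0 < a := lt_trans (by positivity) ha
    exact ne_of_lt (weilEvenGroundEnergy_lt_weilOddGroundEnergy_of_le_13_20 ha0 hle)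
  · exact h a hlt

/-- **`NoParityCrossing` ⟹ no tie beyond `13/20`** (trivial restriction). [folklore] -/
theorem beyond_13_20_of_noParityCrossing (h : NoParityCrossing) :
    ∀ a : ℝ, 13 / 20 < a → weilEvenGroundEnergy a ≠ weilOddGroundEnergy a := by
  intro a ha
  have hl3 := Real.log_three_lt_d9
  exact h a (by linarith)

/-- **Item 18085 after cell `G₁`: `NoParityCrossing` ↔ no parity tie beyond `13/20`.** [folklore] -/
theorem noParityCrossing_iff_beyond_13_20 :
    NoParityCrossing ↔ ∀ a : ℝ, 13 / 20 < a → weilEvenGroundEnergy a ≠ weilOddGroundEnergy a :=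
  ⟨beyond_13_20_of_noParityCrossing, noParityCrossing_of_beyond_13_20⟩

/-- **`GroundStateSimpleEven` (stmt-RiemannHypothesis-1526) ↔ no parity tie beyond `13/20`.** [folklore] -/
theorem groundStateSimpleEven_iff_noParityCrossingBeyond_13_20 :
    GroundStateSimpleEven ↔ ∀ a : ℝ, 13 / 20 < a → weilEvenGroundEnergy a ≠ weilOddGroundEnergy a :=
  GroundStateSimpleEven.groundStateSimpleEven_iff_noParityCrossing.trans noParityCrossing_iff_beyond_13_20

/-- **The crux `EvenWinsBeyondArch` from "no tie beyond `13/20`"** (landed split glue). [folklore] -/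
theorem evenWinsBeyondArch_of_noTie_beyond_13_20
    (hne : ∀ a : ℝ, 13 / 20 < a → weilEvenGroundEnergy a ≠ weilOddGroundEnergy a) : EvenWinsBeyondArch :=
  evenWinsBeyondArch_of_subs WeilParity.onePrimeWindowSimpleEven_proof (noParityCrossing_of_beyond_13_20 hne)

/-- **What the crux still asserts**: `EvenWinsBeyondArch ↔ ∀ a > 13/20, ε_ev(a) ≤ ε_od(a)`. [folklore] -/
theorem evenWinsBeyondArch_iff_forall_le_beyond_13_20 :
    EvenWinsBeyondArch ↔ ∀ a : ℝ, 13 / 20 < a → weilEvenGroundEnergy a ≤ weilOddGroundEnergy a := by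
  rw [evenWinsBeyondArch_iff_forall_le]
  refine ⟨fun h a ha ↦ h a (lt_trans log_two_half_lt_63 (lt_trans (by norm_num) ha)), fun h a ha ↦ ?_⟩
  rcases le_or_gt a (13 / 20) with hle | hlt
  · exact (weilEvenGroundEnergy_lt_weilOddGroundEnergy_of_le_13_20 (log_two_half_pos.trans ha) hle).le
  · exact h a hlt

/-- **A failure of the crux forces an exact parity tie at some window `a > 13/20`.** [folklore] -/
theorem exists_tie_beyond_13_20_of_not_evenWinsBeyondArch (h : ¬ EvenWinsBeyondArch) :
    ∃ a : ℝ, 13 / 20 < a ∧ weilEvenGroundEnergy a = weilOddGroundEnergy a := by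
  by_contra hne
  push Not at hne
  exact h (evenWinsBeyondArch_of_noTie_beyond_13_20 hne)

end Summit.RiemannHypothesis.RiemannHypothesis.Theorems.EvenWinsBeyondArch

/-! ## The route thesis on every window up to `13/20`, and the GroundBarta transport -/

namespace Summit.RiemannHypothesis.RiemannHypothesis.Theorems.WeilParity

open Literature.NumberTheory.LFunctions

/-- **The even sector wins on every window `0 < a ≤ 13/20`** (RH-free): every odd `L²`-normalised Weil test on `[-a, a]`
is matched up to any `δ > 0` by an even one. [folklore] -/
theorem evenSectorWins_upTo_65 :
    ∀ a : ℝ, 0 < a → a ≤ 13 / 20 → ∀ o : ℝ → ℂ,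
      Literature.NumberTheory.LFunctions.IsWeilTest o → tsupport o ⊆ Set.Icc (-a) a →
      (∀ t, o (-t) = -o t) → ∫ t, ‖o t‖ ^ 2 = (1 : ℝ) → ∀ δ : ℝ, 0 < δ →
        ∃ e : ℝ → ℂ, Literature.NumberTheory.LFunctions.IsWeilTest e ∧ tsupport e ⊆ Set.Icc (-a) a ∧
          (∀ t, e (-t) = e t) ∧ ∫ t, ‖e t‖ ^ 2 = (1 : ℝ) ∧
          (Literature.NumberTheory.LFunctions.weilQuadratic e).re ≤
            (Literature.NumberTheory.LFunctions.weilQuadratic o).re + δ :=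
  fun _ ha hle ↦ evenWinsAt_of_le ha
    (EvenWinsBeyondArch.weilEvenGroundEnergy_lt_weilOddGroundEnergy_of_le_13_20 ha hle).le

end Summit.RiemannHypothesis.RiemannHypothesis.Theorems.WeilParity

namespace Summit.RiemannHypothesis.RiemannHypothesis.Theorems.GroundBarta

open Literature.NumberTheory.LFunctions

/-- **GroundBarta's rung 4 from "no tie beyond `13/20`"** (transport along the `Iff.rfl` copy
`GroundBarta.evenWinsBeyondArch_iff_weilParity`). [folklore] -/
theorem evenWinsBeyondArch_of_noTie_beyond_13_20
    (hne : ∀ a : ℝ, 13 / 20 < a → weilEvenGroundEnergy a ≠ weilOddGroundEnergy a) :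
    Summit.RiemannHypothesis.RiemannHypothesis.Theses.GroundBarta.EvenWinsBeyondArch :=
  evenWinsBeyondArch_iff_weilParity.2 (EvenWinsBeyondArch.evenWinsBeyondArch_of_noTie_beyond_13_20 hne)

/-- **What GroundBarta's rung 4 still asserts**: `↔ ∀ a > 13/20, ε_ev(a) ≤ ε_od(a)`. [folklore] -/
theorem evenWinsBeyondArch_iff_forall_le_beyond_13_20 :
    Summit.RiemannHypothesis.RiemannHypothesis.Theses.GroundBarta.EvenWinsBeyondArch ↔
      ∀ a : ℝ, 13 / 20 < a → weilEvenGroundEnergy a ≤ weilOddGroundEnergy a :=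
  evenWinsBeyondArch_iff_weilParity.trans EvenWinsBeyondArch.evenWinsBeyondArch_iff_forall_le_beyond_13_20

end Summit.RiemannHypothesis.RiemannHypothesis.Theorems.GroundBarta

end
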